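import Summits.Parity.GeneralizedHardyLittlewood.Theorems.DilatedTableChowla.Negative.DilatedTableChowlaBlocks

/-!
# `DilatedTableChowla` (stmt-Parity-14271): the crux is EQUIVALENT to its off-diagonal part; the two-point Chowla form of the entries

Negative lemmas for the crux `LiouvilleShiftedTables.DilatedTableChowla` (route LiouvilleShiftedTables, X1; cdisprove seat), landed verbatim from the crux work file `Cruxes/DilatedTableChowla/Disproof.lean` (§9, §12 there) so that skeletons, ideators and provers can import them.  Notation (`rows`, `cols`, `S`, `F`, `lhs`, `crux_iff_lhs`) from `DilatedTableChowlaBlocks`. [folklore]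
-/

namespace Summit.Parity.GeneralizedHardyLittlewood.Theorems.DilatedTableChowla.Negative

open Summit.Parity.GeneralizedHardyLittlewood.Theses.LiouvilleShiftedTables
open Finset

/-! ## §9 (f) STRUCTURAL REDUCTION: the crux is EQUIVALENT to its off-diagonal part

`F = diagF + Foff` with `diagF = Σ_a S(a,a)² ≤ #rows · #cols²`; uniformly in the classes the weighted
diagonal mass is `≤ 12 x²/x^{δ/2}` (`lhsDiag_le`), which is eventually `≤ x²/(2(log x)^C)`. Hence
`DilatedTableChowla ↔ OffDiagonalTableChowla` (`crux_iff_offDiagonal`): ALL the content of the crux is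
cancellation in `S(a,a') = Σ_b λ(ab+c)λ(a'b+c)` for DISTINCT rows `a ≠ a'` of a common class — a
two-point Chowla/Elliott sum for the pair of binary forms `(ab+c, a'b+c)` (determinant `c(a−a') ≠ 0`)
of length `x/A ≥ x^{7/12}` with LARGE coefficients `a, a' ≍ A ≤ x^{5/12}`, averaged over the pairs. -/

/-- The diagonal part of the fourth moment. -/
noncomputable def diagF (c : ℤ) (x A : ℝ) (q u v : ℕ) : ℝ :=
  ∑ a ∈ rows A q u, (S c x A q v a a) ^ 2

/-- The off-diagonal part of the fourth moment (`a ≠ a'`). -/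
noncomputable def Foff (c : ℤ) (x A : ℝ) (q u v : ℕ) : ℝ :=
  ∑ a ∈ rows A q u, ∑ a' ∈ (rows A q u).erase a, (S c x A q v a a') ^ 2

/-- `F = diagF + Foff`. -/
theorem F_eq_diag_add_off (c : ℤ) (x A : ℝ) (q u v : ℕ) :
    F c x A q u v = diagF c x A q u v + Foff c x A q u v := by
  unfold F diagF Foff
  rw [← Finset.sum_add_distrib]
  refine Finset.sum_congr rfl fun a ha => ?_
  rw [Finset.add_sum_erase _ (fun a' => (S c x A q v a a') ^ 2) ha]

/-- `Foff ≥ 0`. -/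
theorem Foff_nonneg (c : ℤ) (x A : ℝ) (q u v : ℕ) : 0 ≤ Foff c x A q u v :=
  Finset.sum_nonneg fun _ _ => Finset.sum_nonneg fun _ _ => sq_nonneg _

/-- `diagF ≥ 0`. -/
theorem diagF_nonneg (c : ℤ) (x A : ℝ) (q u v : ℕ) : 0 ≤ diagF c x A q u v :=
  Finset.sum_nonneg fun _ _ => sq_nonneg _

/-- `Foff ≤ F`. -/
theorem Foff_le_F (c : ℤ) (x A : ℝ) (q u v : ℕ) : Foff c x A q u v ≤ F c x A q u v := by
  rw [F_eq_diag_add_off]; linarith [diagF_nonneg c x A q u v]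

/-- `diagF ≤ #rows · #cols²`. -/
theorem diagF_le (c : ℤ) (x A : ℝ) (q u v : ℕ) :
    diagF c x A q u v ≤ ((rows A q u).card : ℝ) * ((cols x A q v).card : ℝ) ^ 2 := by
  unfold diagF
  calc ∑ a ∈ rows A q u, (S c x A q v a a) ^ 2
      ≤ ∑ a ∈ rows A q u, ((cols x A q v).card : ℝ) ^ 2 :=
        Finset.sum_le_sum fun a _ => S_sq_le c x A q v a a
    _ = _ := by simp

/-- The weighted off-diagonal functional. -/
noncomputable def lhsOff (c : ℤ) (δ x A : ℝ) (u v : ℕ → ℕ) : ℝ :=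
  ∑ q ∈ Finset.Icc 1 ⌊x ^ (δ / 2)⌋₊, (q : ℝ) ^ 3 * Foff c x A q (u q) (v q)

/-- The weighted diagonal functional. -/
noncomputable def lhsDiag (c : ℤ) (δ x A : ℝ) (u v : ℕ → ℕ) : ℝ :=
  ∑ q ∈ Finset.Icc 1 ⌊x ^ (δ / 2)⌋₊, (q : ℝ) ^ 3 * diagF c x A q (u q) (v q)

/-- `lhs = lhsDiag + lhsOff`. -/
theorem lhs_eq_diag_add_off (c : ℤ) (δ x A : ℝ) (u v : ℕ → ℕ) :
    lhs c δ x A u v = lhsDiag c δ x A u v + lhsOff c δ x A u v := by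
  unfold lhs lhsDiag lhsOff
  rw [← Finset.sum_add_distrib]
  refine Finset.sum_congr rfl fun q _ => ?_
  rw [F_eq_diag_add_off]; ring

/-- `lhsOff ≥ 0`. -/
theorem lhsOff_nonneg (c : ℤ) (δ x A : ℝ) (u v : ℕ → ℕ) : 0 ≤ lhsOff c δ x A u v :=
  Finset.sum_nonneg fun q _ => mul_nonneg (by positivity) (Foff_nonneg c x A q (u q) (v q))

/-- `lhsDiag ≥ 0`. -/
theorem lhsDiag_nonneg (c : ℤ) (δ x A : ℝ) (u v : ℕ → ℕ) : 0 ≤ lhsDiag c δ x A u v :=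
  Finset.sum_nonneg fun q _ => mul_nonneg (by positivity) (diagF_nonneg c x A q (u q) (v q))

/-- `lhsOff ≤ lhs`. -/
theorem lhsOff_le_lhs (c : ℤ) (δ x A : ℝ) (u v : ℕ → ℕ) : lhsOff c δ x A u v ≤ lhs c δ x A u v := by
  rw [lhs_eq_diag_add_off]; linarith [lhsDiag_nonneg c δ x A u v]

/-- The crux with `F` replaced by its off-diagonal part `Foff`. -/
def OffDiagonalTableChowla : Prop :=
  ∀ c : ℤ, c ≠ 0 → ∀ δ : ℝ, 0 < δ → δ ≤ 1 / 12 → ∀ C : ℝ, 0 < C → ∃ x₀ : ℝ, ∀ x : ℝ, x₀ ≤ x →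
    ∀ A : ℝ, x ^ δ ≤ A → A ≤ x ^ (1 / 3 + δ) → ∀ u v : ℕ → ℕ,
      lhsOff c δ x A u v ≤ x ^ 2 / Real.log x ^ C

/-- (f) The crux implies its off-diagonal part. -/
theorem crux_imp_offDiagonal (h : DilatedTableChowla) : OffDiagonalTableChowla := by
  rw [crux_iff_lhs] at h
  intro c hc δ hδ hδ' C hC
  obtain ⟨x₀, hx₀⟩ := h c hc δ hδ hδ' C hC
  exact ⟨x₀, fun x hx A hA1 hA2 u v => (lhsOff_le_lhs c δ x A u v).trans (hx₀ x hx A hA1 hA2 u v)⟩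

/-- Window bookkeeping: in the crux's range, `1 ≤ q ≤ x^{δ/2} ≤ A`, `A q ≤ x`, hence
`#rows ≤ 3A/q` and `#cols ≤ 2x/(Aq)`. -/
theorem window_counts {δ x A : ℝ} (hδ : 0 < δ) (hδ' : δ ≤ 1 / 12) (hx : 1 ≤ x) (hA1 : x ^ δ ≤ A)
    (hA2 : A ≤ x ^ (1 / 3 + δ)) {q : ℕ} (hq1 : 1 ≤ q) (hq2 : q ≤ ⌊x ^ (δ / 2)⌋₊) (u v : ℕ) :
    ((rows A q u).card : ℝ) ≤ 3 * A / q ∧ ((cols x A q v).card : ℝ) ≤ 2 * x / (A * q) ∧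
      (q : ℝ) ≤ x ^ (δ / 2) ∧ (q : ℝ) ≤ A ∧ A * q ≤ x ∧ 1 ≤ A := by
  have hxpos : 0 < x := by linarith
  have hqpos : (0 : ℝ) < q := by exact_mod_cast hq1
  have hqx : (q : ℝ) ≤ x ^ (δ / 2) := by
    have := Nat.floor_le (Real.rpow_nonneg hxpos.le (δ / 2))
    exact le_trans (by exact_mod_cast hq2) this
  have hxd : x ^ (δ / 2) ≤ x ^ δ := Real.rpow_le_rpow_of_exponent_le hx (by linarith)
  have h1A : 1 ≤ A := le_trans (Real.one_le_rpow hx hδ.le) hA1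
  have hApos : 0 < A := by linarith
  have hqA : (q : ℝ) ≤ A := hqx.trans (hxd.trans hA1)
  have hAq : A * q ≤ x := by
    calc A * q ≤ x ^ (1 / 3 + δ) * x ^ (δ / 2) := by gcongr
      _ = x ^ (1 / 3 + δ + δ / 2) := by rw [← Real.rpow_add hxpos]
      _ ≤ x ^ (1 : ℝ) := Real.rpow_le_rpow_of_exponent_le hx (by linarith)
      _ = x := Real.rpow_one x
  refine ⟨?_, ?_, hqx, hqA, hAq, h1A⟩
  · have hr := (card_rows_bounds A hApos.le q u hq1).2
    have hfl : ((⌊2 * A⌋₊ : ℝ) - ⌊A⌋₊) ≤ A + 1 := by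
      have h1 : (⌊2 * A⌋₊ : ℝ) ≤ 2 * A := Nat.floor_le (by linarith)
      have h2 : A - 1 < (⌊A⌋₊ : ℝ) := by
        have := Nat.lt_floor_add_one A; linarith
      linarith
    have : ((⌊2 * A⌋₊ : ℝ) - ⌊A⌋₊) / q + 1 ≤ 3 * A / q := by
      rw [div_add_one hqpos.ne', div_le_div_iff_of_pos_right hqpos]; linarith
    exact hr.trans this
  · have hc := (card_cols_bounds x A q v hq1).2
    have hfl : (⌊x / A⌋₊ : ℝ) ≤ x / A := Nat.floor_le (div_nonneg hxpos.le hApos.le)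
    have : (⌊x / A⌋₊ : ℝ) / q + 1 ≤ 2 * x / (A * q) := by
      have hAq' : 0 < A * q := by positivity
      rw [div_add_one hqpos.ne', div_le_div_iff₀ hqpos hAq']
      have : (⌊x / A⌋₊ : ℝ) * A ≤ x := by rwa [← le_div_iff₀ hApos]
      nlinarith
    exact hc.trans this

/-- Uniform bound for the weighted diagonal mass: `lhsDiag ≤ 12 x² / x^{δ/2}`. -/
theorem lhsDiag_le {c : ℤ} {δ x A : ℝ} (hδ : 0 < δ) (hδ' : δ ≤ 1 / 12) (hx : 1 ≤ x)
    (hA1 : x ^ δ ≤ A) (hA2 : A ≤ x ^ (1 / 3 + δ)) (u v : ℕ → ℕ) :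
    lhsDiag c δ x A u v ≤ 12 * x ^ 2 / x ^ (δ / 2) := by
  have hxpos : 0 < x := by linarith
  have hxd2 : 0 < x ^ (δ / 2) := Real.rpow_pos_of_pos hxpos _
  have hxd : 0 < x ^ δ := Real.rpow_pos_of_pos hxpos _
  have h1A : 1 ≤ A := le_trans (Real.one_le_rpow hx hδ.le) hA1
  have hApos : 0 < A := by linarith
  have hterm : ∀ q ∈ Finset.Icc 1 ⌊x ^ (δ / 2)⌋₊,
      (q : ℝ) ^ 3 * diagF c x A q (u q) (v q) ≤ 12 * x ^ 2 / A := by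
    intro q hq
    obtain ⟨hq1, hq2⟩ := Finset.mem_Icc.1 hq
    have hqpos : (0 : ℝ) < q := by exact_mod_cast hq1
    obtain ⟨hr, hcl, -, -, -, -⟩ := window_counts hδ hδ' hx hA1 hA2 hq1 hq2 (u q) (v q)
    have hd := diagF_le c x A q (u q) (v q)
    calc (q : ℝ) ^ 3 * diagF c x A q (u q) (v q)
        ≤ (q : ℝ) ^ 3 * ((3 * A / q) * (2 * x / (A * q)) ^ 2) := by
          gcongr
          exact hd.trans (by gcongr)
      _ = 12 * x ^ 2 / A := by field_simp; ring
  have hQ : ((Finset.Icc 1 ⌊x ^ (δ / 2)⌋₊).card : ℝ) ≤ x ^ (δ / 2) := by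
    rw [Nat.card_Icc, Nat.add_sub_cancel]
    exact Nat.floor_le hxd2.le
  calc lhsDiag c δ x A u v ≤ ∑ q ∈ Finset.Icc 1 ⌊x ^ (δ / 2)⌋₊, 12 * x ^ 2 / A :=
        Finset.sum_le_sum hterm
    _ = ((Finset.Icc 1 ⌊x ^ (δ / 2)⌋₊).card : ℝ) * (12 * x ^ 2 / A) := by
        rw [Finset.sum_const, nsmul_eq_mul]
    _ ≤ x ^ (δ / 2) * (12 * x ^ 2 / x ^ δ) := by gcongr
    _ = 12 * x ^ 2 / x ^ (δ / 2) := by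
        have : x ^ δ = x ^ (δ / 2) * x ^ (δ / 2) := by
          rw [← Real.rpow_add hxpos]; ring_nf
        rw [this]; field_simp

/-- Eventually `K (log x)^C ≤ x^{ε}` (from `isLittleO_log_rpow_rpow_atTop`). -/
theorem eventually_log_rpow_le (K C : ℝ) {ε : ℝ} (hε : 0 < ε) :
    ∃ x₁ : ℝ, ∀ x : ℝ, x₁ ≤ x → K * Real.log x ^ C ≤ x ^ ε := by
  rcases le_or_gt K 0 with hK | hK
  · refine ⟨1, fun x hx => ?_⟩
    have h1 : 0 ≤ Real.log x ^ C := Real.rpow_nonneg (Real.log_nonneg hx) C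
    have h2 : 0 ≤ x ^ ε := Real.rpow_nonneg (by linarith) ε
    nlinarith
  · have hlo := isLittleO_log_rpow_rpow_atTop C hε
    have hev := hlo.def (inv_pos.2 hK)
    obtain ⟨x₁, hx₁⟩ := Filter.eventually_atTop.1 hev
    refine ⟨max x₁ 1, fun x hx => ?_⟩
    have hx1 : x₁ ≤ x := le_trans (le_max_left _ _) hx
    have hx1' : 1 ≤ x := le_trans (le_max_right _ _) hx
    have h := hx₁ x hx1
    rw [Real.norm_of_nonneg (Real.rpow_nonneg (Real.log_nonneg hx1') C),
      Real.norm_of_nonneg (Real.rpow_nonneg (by linarith) ε)] at h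
    calc K * Real.log x ^ C ≤ K * (K⁻¹ * x ^ ε) := by gcongr
      _ = x ^ ε := by field_simp

/-- `2 ≤ log x` for `x ≥ 8`. -/
theorem two_le_log_of_ge_eight {x : ℝ} (hx : 8 ≤ x) : 2 ≤ Real.log x := by
  rw [Real.le_log_iff_exp_le (by linarith)]
  have he := Real.exp_one_lt_d9
  have : Real.exp 2 = Real.exp 1 * Real.exp 1 := by rw [← Real.exp_add]; norm_num
  rw [this]; nlinarith [Real.exp_pos 1]

/-- (f) The off-diagonal statement implies the crux (so they are EQUIVALENT, see below). -/
theorem offDiagonal_imp_crux (h : OffDiagonalTableChowla) : DilatedTableChowla := by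
  rw [crux_iff_lhs]
  intro c hc δ hδ hδ' C hC
  obtain ⟨x₁, hx₁⟩ := h c hc δ hδ hδ' (C + 1) (by linarith)
  obtain ⟨x₂, hx₂⟩ := eventually_log_rpow_le 24 C (half_pos hδ)
  refine ⟨max (max x₁ x₂) 8, fun x hx A hA1 hA2 u v => ?_⟩
  have hx1 : x₁ ≤ x := le_trans (le_trans (le_max_left _ _) (le_max_left _ _)) hx
  have hx2 : x₂ ≤ x := le_trans (le_trans (le_max_right _ _) (le_max_left _ _)) hx
  have hx8 : 8 ≤ x := le_trans (le_max_right _ _) hx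
  have hx1' : 1 ≤ x := by linarith
  have hxpos : 0 < x := by linarith
  have hlog : 2 ≤ Real.log x := two_le_log_of_ge_eight hx8
  have hlogpos : 0 < Real.log x := by linarith
  have hLC : 0 < Real.log x ^ C := Real.rpow_pos_of_pos hlogpos C
  have hoff := hx₁ x hx1 A hA1 hA2 u v
  have hdiag := lhsDiag_le (c := c) hδ hδ' hx1' hA1 hA2 u v
  have h24 := hx₂ x hx2
  have hxd2 : 0 < x ^ (δ / 2) := Real.rpow_pos_of_pos hxpos _
  rw [lhs_eq_diag_add_off]
  -- diagonal part ≤ x²/(2 (log x)^C)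
  have hd : lhsDiag c δ x A u v ≤ x ^ 2 / (2 * Real.log x ^ C) := by
    refine hdiag.trans ?_
    rw [div_le_div_iff₀ hxd2 (by positivity)]
    have : 12 * x ^ 2 * (2 * Real.log x ^ C) = x ^ 2 * (24 * Real.log x ^ C) := by ring
    rw [this]; gcongr
  -- off-diagonal part ≤ x²/(log x)^{C+1} ≤ x²/(2 (log x)^C)
  have ho : lhsOff c δ x A u v ≤ x ^ 2 / (2 * Real.log x ^ C) := by
    refine hoff.trans ?_
    rw [Real.rpow_add_one hlogpos.ne' C]
    apply div_le_div_of_nonneg_left (by positivity) (by positivity)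
    nlinarith
  have : x ^ 2 / (2 * Real.log x ^ C) + x ^ 2 / (2 * Real.log x ^ C) = x ^ 2 / Real.log x ^ C := by
    field_simp; ring
  linarith

/-- (f) **The crux is EQUIVALENT to its off-diagonal part.** -/
theorem crux_iff_offDiagonal : DilatedTableChowla ↔ OffDiagonalTableChowla :=
  ⟨crux_imp_offDiagonal, offDiagonal_imp_crux⟩



/-! ## §12 (l) THE TWO-POINT CHOWLA FORM of the correlations (for provers)

Multiplying by `λ(a)λ(a')`: `λ(ab+c)λ(a'b+c) = λ(a)λ(a') · λ(aa'b + a'c) λ(aa'b + ac)`, so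
`S(a,a') = λ(a)λ(a') Σ_{b ∈ cols} λ(n + a'c) λ(n + ac)` with `n = aa'b` running over the multiples of
`aa'` (intersected with the column class): a genuine two-point Chowla sum `λ(n+h₁)λ(n+h₂)`,
`h₁ − h₂ = (a'−a)c ≠ 0`, along an arithmetic progression of modulus `aa' ≍ A²` with `x/A` terms —
for `A > x^{1/3}` FEWER terms than the modulus. Nearest theorem in print for a FIXED pair:
Tao, arXiv:1509.05422, Thm 1.2 (log-averaged two-point Chowla for `λ(a₁n+b₁)λ(a₂n+b₂)`,
`a₁b₂ − a₂b₁ ≠ 0`, saving `o(1)`); the crux needs it uniformly for `a, a' ≤ x^{5/12}` (length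
`x/A ≥ x^{7/12}`), unweighted, with a `(log x)^{-C}` saving on average over pairs — far beyond print,
but no Ω-result contradicts it. -/

/-- `L(m n) = L m · L n` for a natural `m` and an integer `n ≥ 0`. -/
theorem L_natCast_mul_of_nonneg (m : ℕ) {n : ℤ} (hn : 0 ≤ n) : L ((m : ℤ) * n) = L m * L n := by
  obtain ⟨k, rfl⟩ := Int.eq_ofNat_of_zero_le hn
  exact L_natCast_mul m k

/-- (l) `S(a,a') = λ(a)λ(a') · Σ_b λ(aa'b + a'c) λ(aa'b + ac)` for rows `a, a' ≥ 1` once all entries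
are positive (automatic for `c ≥ 0`, and for `c < 0` as soon as `A ≥ |c|`, see `entries_pos`). -/
theorem S_eq_twoPoint {c : ℤ} {x A : ℝ} {q v a a' : ℕ} (ha : 1 ≤ a) (ha' : 1 ≤ a')
    (hpos : ∀ b ∈ cols x A q v, 0 < (a : ℤ) * b + c ∧ 0 < (a' : ℤ) * b + c) :
    S c x A q v a a' = L a * L a' *
      ∑ b ∈ cols x A q v, L ((a : ℤ) * a' * b + a' * c) * L ((a : ℤ) * a' * b + a * c) := by
  unfold S
  rw [Finset.mul_sum]
  refine Finset.sum_congr rfl fun b hb => ?_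
  obtain ⟨h1, h2⟩ := hpos b hb
  have e1 : L ((a : ℤ) * a' * b + a' * c) = L a' * L ((a : ℤ) * b + c) := by
    rw [show (a : ℤ) * a' * b + a' * c = (a' : ℤ) * ((a : ℤ) * b + c) by ring]
    exact L_natCast_mul_of_nonneg a' h1.le
  have e2 : L ((a : ℤ) * a' * b + a * c) = L a * L ((a' : ℤ) * b + c) := by
    rw [show (a : ℤ) * a' * b + a * c = (a : ℤ) * ((a' : ℤ) * b + c) by ring]
    exact L_natCast_mul_of_nonneg a h2.le
  have sa : L a * L a = 1 := L_mul_self_of_pos (by exact_mod_cast ha)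
  have sa' : L a' * L a' = 1 := L_mul_self_of_pos (by exact_mod_cast ha')
  rw [e1, e2]
  linear_combination (-(L ((a : ℤ) * b + c) * L ((a' : ℤ) * b + c) * (L a' * L a'))) * sa
    + (-(L ((a : ℤ) * b + c) * L ((a' : ℤ) * b + c))) * sa'

/-- All entries are positive once `A ≥ |c|` (so `Int.toNat` never truncates inside the window). -/
theorem entries_pos {c : ℤ} {x A : ℝ} (hA : (|c| : ℝ) ≤ A) {q u v a b : ℕ} (ha : a ∈ rows A q u)
    (hb : b ∈ cols x A q v) : 0 < (a : ℤ) * b + c := by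
  have ha1 := (mem_rows.1 ha).1.1
  have hb1 : (1 : ℤ) ≤ b := by exact_mod_cast one_le_of_mem_cols hb
  have hcA : |c| < (a : ℤ) := by
    have hfl : A - 1 < (⌊A⌋₊ : ℝ) := by have := Nat.lt_floor_add_one A; linarith
    have hfa : ((⌊A⌋₊ : ℕ) : ℝ) + 1 ≤ a := by exact_mod_cast ha1
    have h' : ((|c| : ℤ) : ℝ) < ((a : ℤ) : ℝ) := by
      rw [Int.cast_abs]; push_cast; linarith
    exact_mod_cast h'
  have : -c ≤ |c| := neg_le_abs c
  nlinarith

end Summit.Parity.GeneralizedHardyLittlewood.Theorems.DilatedTableChowla.Negative
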